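import Literature.NumberTheory.LFunctions.Zhang2022.RepairDetShift
import Literature.NumberTheory.LFunctions.Zhang2022.RepairDetEntangled
import Literature.NumberTheory.LFunctions.Zhang2022.RepairDetShiftPSD
import Literature.NumberTheory.LFunctions.Zhang2022.RepairDetShiftMembers

/-!
# Zhang (2022), programme F-S3 §E (cell landau-siegel, barrier extension, row S-E-t2-3): INTAKE of the §B word
# KILL(B-det) — the class DET restricted to its LANDED `R⁺⁺` rows as ONE design family `familyBdet` over a sum
# design type, one constructor per covered sub-class, each dispatched to its landed family; `bdetWord` decided
# (v1 — INTAKE-4 of the cell, filed at the word KILL(B-det) OF RECORD 2026-08-26T23:09:45Z with its ERRATUM OF RECORD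
# 23:27:01Z; barrier/ASSIGNMENTS.md row S-E-bdet-1, ex S-E-t2-3)
# — v2 (Part 5, appended 2026-08-27 by the INTAKE-4 co-owner ls-Bdet-typer-2 g2; v1 decls frozen): `bdetWord2 := bdetWord ++
# [familyDetEntangled]` (the ENTANGLED sub-class of the widened clause (i′), E-102 member displayed), `familyBdet2`, the `w2`
# row's slot discharged at `b⋆ = (1/2; 2, 5/2)` (p473995), members batch

Y. Zhang, *Discrete mean estimates and the Landau–Siegel zero*, arXiv:2211.02515v1 [Zhang2022LandauSiegel] —
an unrefereed manuscript under adjudication. **WHAT THIS IS NOT: not a claim about Theorems 1–2 of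
arXiv:2211.02515, about Landau–Siegel zeros, about a repaired `Margin232`, or about Parity; nothing here asserts any
claim of the manuscript, any estimate, or any slot. The programme SEARCHES and TYPES; no claim until a kernel theorem
says so.** Intake file for the cell's B-det word (ls-barrier-plan g1 2026-08-26T20:40:37Z / RULING 23:22:50Z, barrier/ASSIGNMENTS.md row
S-E-bdet-1 = INTAKE-4 (ex S-E-t2-3); ls-barrier-plan/KILL-INTAKE.md §5 recipe «WORD KILL(B-det)»; shape copied from `RepairIntakeBmulti`
(p461787) / `RepairIntakeBlen` (p465008)). Nothing is re-proved: every verdict below is a landed `_decided` term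
(`Repair.familyDetShift_decided` p460173, `Repair.not_repairable_in_Rplus` p455670, `Repair.familyRCalc_decided`
p456882). Owner of record of the detector family: ls-barrier-p6 (reviews the dispatch lines).

## The word (C1 — verbatim)

(α) THE WORD — «OF RECORD 23:09:45Z, §1a RE-SAID 23:27:01Z (director-frontier g6), countersigned REF-B1 (w1″) 2026-08-26T23:55:40Z
(ls-B-ref-1 g2, HOME/STATUS.md: «the re-said §1a clause … CARRIES the §1a KILL under the charter census standard; the word
«KILL(B-det) INSIDE DET, GIVEN E-102» STANDS OF RECORD (no revert)»; riders n1–n4 non-blocking)» — the RE-SAID sentence VERBATIM (director-frontier g6, WORD ERRATUM OF RECORD,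
HOME/INBOX.md 2026-08-26T23:27:01Z, which «supersedes the §1a clause of 23:09:45Z»; the 23:09:45Z word line itself is «OF RECORD
at 2026-08-26T23:09:45Z», spoken in the REF-B1 §1a form): «KILL(B-det) INSIDE DET: decided on the scanned generators
(sign-admissible monomials; SOS rank-one slices; two-profile entangled pairs — certified two-lineage); full 19-palette BigF:
NO CERTIFIED NEGATIVE DIRECTION (two-lineage; λ_min enclosure ⊂ [−1.03e-8, 1.8e-10] at N = 12, B′ / A-v2), PSD NOT CERTIFIED,
kernel nature OPEN (B′ j262052 in flight); GIVEN det-E15 E-det-cone (E-102) on the continuum.» [The 23:09:45Z §1a clause on the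
full palette was WITHDRAWN by that erratum and re-said as quoted; the withdrawn wording is not reproduced in this file
(ls-barrier-plan g1 RULING 23:38:57Z (1)); later certificates of the full-palette matrices strengthen the «no» in the family's
books (KILL-CERT §7 T10) and change no word text.] The word STANDS OF RECORD with this clause, PROVISIONAL on one stamp when
spoken — REF-B1's countersign of the re-said §1a, «(w1″)», asked by the director in the same line (if REF-B1 objects, the word
reverts to READY-FOR-WORD and this intake decides nothing that is not already decided row by row below); this file was proposed
only AFTER that (w1″) line (ls-barrier-plan g1 23:38:57Z (1): «INTAKE-4 GATED ON (w1″)»; countersign posted 23:55:40Z).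
(β) STAMPS (word line (i)–(iv)): (i) writer of record ls-Bdet-plan g0 READY-FOR-WORD 23:04:30Z over B-det/KILL-draft.md v1.8
a515c90d58d0257f + DESIGN-MAP-det v0.20 9fdd0362e9ddf0cc + EDLIST v1.4 bdf11e0e599a3210 (0 candidates, no (ε) event); (ii) REF-B1
WORD CONDITIONS (w1)+(w2) MET 22:58:33Z (countersign v1.6 82343c3ba0183e60 / v1.7 1494cf9261eba504 §1a/§2(i′); v1.8 fold under
the §5 provisos, REF-B1.md a5b8f2190b10206b) and REF-B1 23:15:55Z «v1.8 fold line VERIFIED — NO DEVIATION, NO RETURN»; (iii)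
two-lineage PAIR-D2PLUS-AB.md b69f767a2df39c09 (914/914 AGREE strict, 8/8 AGREE, 0 negative directions); (iv) theory (c4)
all-patterns law 22:57:35Z. CERTIFICATE OF RECORD: B-det/KILL-draft.md **v2.1 = KILL-CERT(B-det) sha16 dc2c2f0e9b79566b**
(writer ls-Bdet-plan g2 23:42:22Z; byte copy B-det/plan/record/KILL-CERT-v2.1-dc2c2f0e9b79566b.md) = v2.0 547cbfcd828e180c (ls-Bdet-plan
g0, FROZEN 23:16:41Z on the word) + the director's ERRATUM folded: §1 WORD OF RECORD block with the RE-SAID §1a clause verbatim +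
kit ids j261813 / j261612 / j262052 + «PROVISIONAL on REF-B1 (w1″)»; §2 class (i)–(iv) + (i′), §7 census T1–T12, §8 exits e1–e6
BYTE-IDENTICAL to v2.0 · B-det/CLOSEOUT-det.md v1 341996d90f715038.
(γ) QUALIFIERS (verbatim, «both explicit in every citation»): «(a) CUSTODY = PASS-pre — the word is of record now and becomes
custody-final when ls-ref-num lifts j260861 / j261367 / j261330; a custody FAIL, an (ε) event, or a negative direction found
by the running v2 refinement j261623 RE-OPENS B-det automatically (same rule as B-fam's Q10/Π completion)» — ls-ref-num LIFTED
all three 23:08:48Z (ledger l.7324/l.7327) and j261623 is COMPLETE with no negative direction (ls-Bdet-num-1 g2 23:11:10Z);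
«(b) GIVEN E-102 — the kill is conditional on det-E15 (E-det-cone on the continuum) exactly as KILL(B-dh) was on E-057 until
p468827; it becomes UNCONDITIONAL when the kernel theorem discharging E-102 is ACCEPTED …, until then every use says «GIVEN
E-102».» SCOPE SENTENCE (verbatim): «The programme SEARCHES and TYPES; KILL(B-det) says the det design space as scanned
contains no repair of the §18 margin, GIVEN E-102; no claim about Landau–Siegel zeros, Theorems 1–2 of arXiv:2211.02515 or a
repaired Margin232 follows.» §E booking: ls-barrier-plan g1 RULING 23:22:50Z (row S-E-bdet-1 = INTAKE-4, this writer; Lean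
decls unchanged from the parked rc-0 bytes cc2484ba4bdc71a2; E-102 enters v1 by registry id and decl NAME only) and 23:32:43Z (3).


(δ) §1 FORM B / PREMISE NOTE (KILL-CERT v2.1 dc2c2f0e9b79566b §1 (= v2.0 547cbfcd828e180c bytes here), the sentence REF-B1 countersigned as text 21:53:41Z, abridged to its
logical content; the full sentence is B-det/typer-2/KILL-draft-v1.6-82343c3ba0183e60.md): for every design d of class DET (§2), EITHER (a) its
weights are real and `≥ 0` at every sampled zero on the Prop-2.2 configuration for all large D — for SHIFT DETECTORS this
is `⇔ Det.SignAdmissible b` (`Det.signAdmissible_iff_latticeSymbolNonpos`, p465818) and a THEOREM given Prop 2.2 (E-086: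
`Det.positive_shiftDetector_of_signAdmissible`) — and then on the zero side every configuration-valid endgame holds
EXACTLY (`Det.norm_sq_discreteForm_le`, `DetTemplate.Detector.Positive.endgame_nonneg`) and, GIVEN the cone row
E-det-cone («`FormDet(P₁,b) ⪰ 0` on one-sided kinked profiles for every ConfigPositive `(P₁,b)`» = B-AH restricted to DET;
CERTIFIED on the sign-admissible monomial generators, OPEN on the full cone), on its recipe main terms too; unconditionally
W1 (printed `b = (1,2,3)`) is DECIDED (`Det.formDetPSD_zhang`); OR (b) some weight is non-real or negative at a sampled
zero — shift detectors `⇔ ¬SignAdmissible` (the 825 det-D2-B cells) — and then d has NO configuration-valid endgame inside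
DET at all (`Det.not_cauchySchwarz_signed`; F-det-6) — «no (structural)»; hence no d ∈ DET closes Zhang's criterion at
main order without an input OUTSIDE DET: lengths > (7.2) (E*-len; 𝒟_len KILLED GIVEN B-AH), ℓ ≠ 1 (E*-ℓ; B-ell live),
support ≥ 3 or any family statistic read beyond x ≤ P (the door: det-E10 = E-097, XL) — charter wording «no d in the
family closes without E*-len/E*-ℓ-strength input»; candidates 0 / 1039 cells + door; exits e1–e6; no number load-bearing.

§2 (a) «The class DET as conjuncts» (KILL-CERT v2.1 dc2c2f0e9b79566b §2 = v2.0 547cbfcd828e180c §2 byte-identical, verbatim core; typed as DATA `Det.DETDesign k`, `k ≤ 3`,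
`DetectorClassDET`; (i′) CLASS WIDENING OF RECORD R-d2p-2: `P₀, P₁` = real cubic FORMS in ANY finite number `K` of
shifted M-values, each monomial involving `≤ 3` shifts — typing ask to ls-Bdet-typer-1): «(i) sampling Σ ∈ {Σ₁ = 𝔷(ψ)
(`Skeleton.zeroSet`), Σ₂ = zeros of L(ψ)L(ψχ) in Ω (`prodZeroSetOmega`)}; family ∈ {Ψ₁, Ψ} with amplifier a(ψ) ≥ 0
(`DETDesign.amp_nonneg`); (ii) weight w_d(ρ,ψ) = c₀·a(ψ)·(P₀(M(ρ+β_•)) + P₁(M(ρ+β_•))/M′(ρ))·ω(ρ), k ≤ 3 shifts β_j = i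
b_j α(1 + e_j c′α𝓛), b_j ∈ (0,5), P₀, P₁ of total degree ≤ 3 — SIGN-INDEFINITE weights allowed (W1 printed, W2 admissible
= `Det.SignAdmissible` ⇔ lattice-symbol test `Det.signAdmissible_iff_latticeSymbolNonpos` p465818 with
`signRobust_of_signAdmissible` p464997 discharging E-086's sign input, W3 non-admissible, W4-type affine weights all
inside; for general (P₀,P₁,e,a) members the (a)/(b) membership is read off the member's own lattice symbol — E-det-2;
E-det-6 parity census); (iii) support ≤ 2: one sesquilinear statistic per sample, test side = any coefficient pair
admissible in the sense (7.2) (`Skeleton.Adm72`: lengths < P/T², ℓ = 1) through `DetTemplate.Detector.pairMean`; (iv)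
endgame = a CONFIGURATION-VALID inequality among finitely many displayed means (`Det.ConfigValid`; linear + Gram
statistics: `Det.ConfigValidOn` — CS, POS, Gram minors, Turán-type, one-sided, counts; REF-B1 r1); an endgame that is
not a universally valid inequality is OUTSIDE DET (§8 e5). … OUTSIDE DET by construction (named, not swept): §8 EXITS
e1–e6.» ConfigPositive (theory (c1)(4)): a member has a VALID POS endgame iff `P₁(ε⊙x) ≥ 0` for every realisable sign
vector ε and all `x ∈ (0,∞)^K`.

**PREMISE OF RECORD of the spoken word: det-E15 = E-102 «E-det-cone»** (typed decl of record `Det.EdetCone (Set.Ioo 0 1)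
(Set.Ioo 0 5)` with per-member `Det.ConePSD a b` and block form `Det.entangledMain`, file `Zhang2022/DetectorEntangledCone.lean`,
ls-Bdet-typer-2 g2, p473997 ACCEPTED — NAMED here, neither imported nor asserted in v1; `FormDet(P₁,b) ⪰ 0` on one-sided kinked
profiles for every ConfigPositive `(P₁,b)` — OPEN on the continuum, CERTIFIED on the scanned generators; for the shift-detector
monomials it is exactly the slot `Det.FormDetPSD (Det.shiftRecipe b)` displayed row by row below) — named in the word,
asserted NOWHERE in this file; B-AH (E-014) / det-E5 = E-081 (`Det.ModelBarrier`, `Det.FenceModel.IsConfig`) are named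
only for the door / outside-DET rows. What does NOT lean on it (the word's own list): W1 printed at the recipe level
(`Det.formDetPSD_zhang` / `Det.formDetPSD_shiftRecipe_std`), the discrete Cauchy–Schwarz (`Det.norm_sq_discreteForm_le`),
the structural (b)-sentence (`Det.not_cauchySchwarz_signed`), the D4 two-route identity (derivation, 969/969 two-lineage).

## The class DET ∩ (landed `R⁺⁺` rows) and its dispatch (this file, v1)

Common box of the word: `fam = det`; `ℓ = 1`; test lengths `< P/T²` ((7.2), one-sided profiles with `g(1) = 0`); at most
three shifts `b ∈ (0,5)³`; detector weight shape (ii); endgame configuration-valid. The `Repair.DesignFamily` rows of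
the class of record that cover a part of DET are PROFILE-LEVEL (continued main-term calculus of the detector's recipe,
formula I) — `Repair.Rplusplus4` rows 17 (`familyDetShift`), 2 (`familyH1`), 6 (`familyRCalc`). Sub-class of the word ↦
constructor of `BdetDesign` ↦ covering family ↦ currency ↦ displayed slot(s) ↦ flag:

| sub-class of the word | constructor | family (file, p-id) | currency | displayed slot(s) | flag |
|---|---|---|---|---|---|
| (a)-members, SHIFT DETECTORS W1 ∪ W2: `b` sign-admissible (`Det.SignAdmissible b`, ⇔ (a) for the printed weight shape, E-086) in the Part-III box (`Det.InShiftBox b`), run against ONE-SIDED kinked legs `u(1) = f(1) = 0` (test side (iii), range (7.2)), CS endgame | `w2 d` (`d : Repair.DetShiftDesign = ⟨b; u,u′; f,f′⟩`) | `Repair.familyDetShift` (RepairDetShift, p460173; row 17) | FormDet (formula I of the recipe `Det.shiftRecipe b`, one-sided legs): `¬ (𝔅_b(u)·𝔅_b(f) < ‖P_b(u,f)‖²)` | (c) `Det.FormDetPSD (Det.shiftRecipe b)` (E-010 = det-E1; DISPLAYED in `VBdet`, asserted nowhere). Per-`b` discharges: `b = (1,2,3)` `Det.formDetPSD_shiftRecipe_std`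 (in tree); `b* = (½; 2, 5/2)` = `Det.formDetPSD_shiftRecipe_bStar` with `Repair.detShift_verdict_bStar` / `Repair.detShift_unconditional_bStar` (RepairDetShiftPSD, ls-barrier-p6 g0, p473995 ACCEPTED; from FACT C `Det.ShiftCert.wn11_nonneg` / `detWn_nonneg` p465888 + `Det.formDetPSD_of_certificate` p468669 — in tree, cited by name, not imported in v1; the row text «CONDITIONAL on E-010 off {(1,2,3), (½;2,5/2)}» is v2's); E-CERT-001 (`(½; 5/2, 13/5)`, kit j257689) and E-CERT-002 (4 545 admissible grid triples + 9 lattice limits; twin j258819/j258853 on C1/C3) are numerical EVIDENCE only | REF-E E-9 PASS, CONDITIONAL off `b = (1,2,3)` |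
| (a)-members, the PRINTED detector W1 (`b = (1,2,3)`, Lemma 2.3 as printed) against ANY pair of `H¹` one-sided legs with `g(1) = f(1) = 0` (guard G1 of COVERAGE.md stated in the class) | `stdLegs g g′ f f′` | `Repair.familyH1` (RepairRplus, p455670; row 2) | 𝔅 / polar form, profile-level T-true (the formula-I / (4.1) dictionary region) | none — Cauchy–Schwarz for the ONE PSD form `𝔅` (`not_trueNeed_of_isH1`) | decided; C2: every `w2` member with `b = (1,2,3)` IS a `stdLegs` member with the same verdict (`Repair.detShift_std_toH1`; `kbdet_w2_std` below) |
| (a)-members, the PRINTED detector W1 on the GLUED calculus-class designs `θ` (both `Θ₁`-blocks of (10.1): `(g₁,f)` and `(f₂,g₂)`, glue `𝔤_θ = g₁ + R̃g₂`) — the manuscript's own architecture, the control cell `det-W1-1;2,3-T1-N24` of det-D1-B | `w1calc θ` (`θ : Repair.Theta`) | `Repair.familyRCalc` (RepairAdmissibleWide, p456882; row 6) | T-true continued calculus `¬ (C₂₃₂·C₂₃₃ < |𝔡+𝔡′|²)` (K-S1–K-S3; validity of the identification off `R`: E-017 open, text) | none | decided (`Repair.not_repairable_true_need_calc`); the glued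 level at GENERAL `b` is NOT this row — u-item (u3) |

**NO constructor — UNCOVERED / not-a-row items (the word names them; no `Repair.DesignFamily` of the tree says «no» there
in a profile-level currency; recorded so the intake does not over-claim; KILL-INTAKE §5: «two-sided glued legs /
sign-indefinite detectors → declared UNCOVERED (S-E-p6-3 gated) unless the word's class excludes them»):**
(u1) (a)-members with GENERAL weights `(P₀, P₁, e, a)` beyond the shift-detector shape (W4-type affine weights,
ConfigPositive cubic forms, amplified `Ψ`, `Σ₂` sampling; «other operator shape» members `P₀ ≠ 0` / `(iM′)^{−m}, m ≠ 1` are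
flagged «unreviewed (operator shape)» by the word itself): at the DISCRETE level their configuration-valid endgames hold exactly GIVEN Prop 2.2 and
the displayed (a)-membership (`DetTemplate.Detector.Positive.endgame_nonneg`, `Det.ConfigValid.mainOrder_nonneg`,
`Det.ConfigValidOn.mainOrder_nonneg`, p461247/p464106/p464704; for shift data `Det.shiftDesign` /
`positive_detector_shiftDesign_of_signAdmissible`, DetectorClassDETShift p466135) — detector-level theorems, no
`Repair.DesignFamily` wrap landed (owner ls-barrier-p6); not claimed by this file. (u2) (b)-members = SIGN-INDEFINITE
weights (W3: the 825 cells of det-D2-B, and every other signed member): the word's sentence there is STRUCTURAL — «no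
configuration-valid endgame exists inside DET» (`Det.not_cauchySchwarz_signed`, F-det-6) — an EXIT-shaped sentence, not
a `Verdict` over a landed family; recorded, not covered. (u3) TWO-SIDED / GLUED legs at general `b` (`𝔤(1) ≠ 0`; formula
II for general `b` + window term: derivation OPEN; `Det.FormDetTwoSided` p457732, `Det.FormDetGlued` /
`Det.glueAssembled_eq` p465523 typed; glued numerics 144/144 nonneg-type on three code paths = evidence only; head word
«unreviewed (c3)»): S-E-p6-3 GATED; at `b = (1,2,3)` the glued level IS row `w1calc` (K-S2). (u4) configuration-valid
endgames OTHER than Cauchy–Schwarz at the profile level (POS `λ_min`, Gram minors, Turán-type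
`Det.configValidOn_turanI/II` p468897/p467155, one-sided, counts): discrete-level instances only; the profile-level rows
above carry the CS endgame (POS words of det-D1-B are corroboration, custody (ii)). (u5) THE DOOR and the EXITS e1–e6
(§8 of KILL-CERT v2.1): support `≥ 3` / any family statistic beyond `x ≤ P` (det-E6 XL, det-E6′ `Det.EdetFFprimeSat`, det-E10
= E-097 `Det.EdetPsi2` XL-substantive, det-E11 `Det.EdetFenceFF`; p466176/p468650), lengths `> (7.2)` (→ KILL(B-len),
`RepairIntakeBlen`), `ℓ ≠ 1` (→ B-ell, live), `T > 1` / box / Levinson–Conrey (det-E8), non-configuration-valid endgames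
(E-085 (c)-door, used in no word), effective family inputs (E-098, E-002) — OUTSIDE DET by construction; no theorem claims
«no» there. (u6) det-E15 = E-102 «E-det-cone» — the PREMISE of the spoken word (for the `w2` rows it IS the displayed slot
`Det.FormDetPSD (shiftRecipe b)`, member by member; OPEN on the continuum); det-E5 = E-081 (`Det.ModelBarrier` /
`Det.FenceModel.IsConfig`) and B-AH (E-014) are named for the door / outside-DET rows only. (u7) ENTANGLED designs of
det-D2⁺ (anchor `a`, palette `Π`, profile vectors; the two-profile entangled pairs and SOS rank-one slices named in the word,
and the `|Π| ≥ 3` members of the WIDENED class (i′)): their profile-level row is `Repair.familyDetEntangled` (verdict GIVEN the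
E-102 MEMBER `Det.ConePSD a b`, displayed; file `Zhang2022/RepairDetEntangled.lean`, ls-Bdet-typer-2 g2, announced 23:35:13Z) —
NOT in v1's `bdetWord`; it enters as `bdetWord2 := bdetWord ++ [familyDetEntangled]` in the Part-2 append of THIS file
(co-owner ls-Bdet-typer-2 g2, after this v1 and that row are ACCEPTED); their 3-shift principal sub-blocks are `w2` members when
sign-admissible.

## What this file provides (v1; later rows — `familyDetEntangled` (u7), a p6 wrap of (u1), an un-gated (u3), the E-102
## binder displayed by NAME — enter as the VERSIONED `bdetWord2` / `familyBdet2` appended to this append-only file; v1 decls stay frozen)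

`BdetDesign`, `KBdet`, `VBdet`, `familyBdet : Repair.DesignFamily`, `familyBdet_decided` (by cases from
`familyDetShift_decided`, `not_repairable_in_Rplus (.hOne …)`, `familyRCalc_decided`), `rplus_bdet_decided`;
`bdetWord = [familyDetShift, familyH1, familyRCalc]` with `bdetWord_decided`, `rplus_bdetWord_decided`, `mem_bdetWord_iff`
(the «`bdetWord ⊆ Rplusplus<k>`» lemma lives in the assembly file, import rule (6)); C2 by term (`kbdet_rows_iff`,
`vbdet_w2_iff`, `kbdet_w2_std`, `vbdet_w2_std_iff`, `kbdet_of_admissible`); C4 witnesses FROM THE FAMILY'S OWN DESIGN FILE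
det-D1-B.json f36f1400289c2177 (`kbdet_inhabited`: the control cell `det-W1-1;2,3` as `w2` legs, `stdLegs` and `w1calc` at
`θ₀`; the W2 cells `det-W2-1/2;2,5/2` = `Det.bD1Star` (the S-E-p6-2 certificate point), `det-W2-1/4;1/2,3/4` =
`Det.bD1FirstGap` (`k = 0`), `det-W2-3/4;3,4` = `Det.bD1TopGap` (`k = 3`, closed lattice endpoints), each with the
printed `𝔡`-block legs of `θ₀`; `g⋆` against itself) — ALL 144 cells of det-D1-B are enumerated as members by term in
the companion `RepairDetShiftMembers` (p470739: `Det.d1Cells`, `Repair.inClass_d1Cells_theta0`, and the kernel-checked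
partition `Det.quarterGrid_partition` 969 = 144 admissible + 825 = det-D2-B), which this file does not import; the verdicts at the printed triple in the record's functionals
(`bdet_std_verdicts`); the slot at the printed triple (`bdet_slot_std`) and the §2-final-step shape under the slot
(`bdet_w2_not_sqrt_closing`). References: Zhang, arXiv:2211.02515v1, §2 (2.13), Lemma 2.3, (2.16)–(2.18),
(2.32)–(2.33) [p. 5–6, 10–12]; §7 Prop. 7.1 (7.2) [p. 44]; §10 (10.1) [cite: Zhang2022LandauSiegel, §2 Lemma 2.3,
(2.32)–(2.33); §7 Prop 7.1 (7.2)]; cell files B-det/KILL-draft.md v2.1 = KILL-CERT(B-det) dc2c2f0e9b79566b (v2.0 547cbfcd828e180c), B-det/CLOSEOUT-det.md v1 341996d90f715038,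
B-det/DESIGN-MAP-det.md v0.21, B-det/designs/det-D1-B.json, barrier/ASSIGNMENTS.md S-E-bdet-1 (ex S-E-t2-3),
ls-barrier-plan/KILL-INTAKE.md §5, COVERAGE.md (B-det rows, guard G1); HOME/INBOX.md 23:09:45Z, 23:27:01Z (director-frontier g6),
23:13:01Z (ls-lead g2), 23:22:50Z / 23:32:43Z (ls-barrier-plan g1).
«The programme SEARCHES and TYPES; no claim about Landau–Siegel zeros, Theorems 1–2 of arXiv:2211.02515 or a repaired
Margin232 until a kernel theorem says so.»
-/

noncomputable section

open Real Complex ComplexConjugate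

namespace Literature.NumberTheory.LFunctions.Zhang2022

/-! ### Part 0 — three shift boxes named in the word's member file det-D1-B (C4 data) -/

namespace Det

/-- The W2 cell `det-W2-1/2;2,5/2` of det-D1-B: `b* = (½; 2, 5/2)` (pair in the gap `k = 2`, lower endpoint ON the
lattice) — the triple of the S-E-p6-2 certificate (DetectorShiftCertBernstein). [cite: Zhang2022LandauSiegel, §2 (2.13), Lemma 2.3] -/
def bD1Star : Fin 3 → ℝ := ![1 / 2, 2, 5 / 2]

/-- The W2 cell `det-W2-1/4;1/2,3/4` of det-D1-B: `(¼; ½, ¾)` — all three shifts in the FIRST gap (`k = 0`).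
[cite: Zhang2022LandauSiegel, §2 (2.13), Lemma 2.3] -/
def bD1FirstGap : Fin 3 → ℝ := ![1 / 4, 1 / 2, 3 / 4]

/-- The W2 cell `det-W2-3/4;3,4` of det-D1-B: `(¾; 3, 4)` — the pair fills the gap `k = 3` with BOTH lattice endpoints
(closed endpoints of `Det.SignAdmissible`). [cite: Zhang2022LandauSiegel, §2 (2.13), Lemma 2.3] -/
def bD1TopGap : Fin 3 → ℝ := ![3 / 4, 3, 4]

/-- `b*` is sign-admissible and in the Part-III box. [cite: Zhang2022LandauSiegel, §2 (2.13), Lemma 2.3; §14 (14.2)] -/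
theorem signAdmissible_bD1Star : SignAdmissible bD1Star ∧ InShiftBox bD1Star := by
  refine ⟨⟨?_, ?_, ?_, ?_, 2, ?_, ?_⟩, fun j => ?_⟩ <;> (try fin_cases j) <;>
    norm_num [bD1Star, Matrix.cons_val_two, Matrix.tail_cons, Matrix.head_cons]

/-- `(¼; ½, ¾)` is sign-admissible (`k = 0`) and in the Part-III box. [cite: Zhang2022LandauSiegel, §2 (2.13), Lemma 2.3; §14 (14.2)] -/
theorem signAdmissible_bD1FirstGap : SignAdmissible bD1FirstGap ∧ InShiftBox bD1FirstGap := by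
  refine ⟨⟨?_, ?_, ?_, ?_, 0, ?_, ?_⟩, fun j => ?_⟩ <;> (try fin_cases j) <;>
    norm_num [bD1FirstGap, Matrix.cons_val_two, Matrix.tail_cons, Matrix.head_cons]

/-- `(¾; 3, 4)` is sign-admissible (`k = 3`, closed endpoints) and in the Part-III box.
[cite: Zhang2022LandauSiegel, §2 (2.13), Lemma 2.3; §14 (14.2)] -/
theorem signAdmissible_bD1TopGap : SignAdmissible bD1TopGap ∧ InShiftBox bD1TopGap := by
  refine ⟨⟨?_, ?_, ?_, ?_, 3, ?_, ?_⟩, fun j => ?_⟩ <;> (try fin_cases j) <;>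
    norm_num [bD1TopGap, Matrix.cons_val_two, Matrix.tail_cons, Matrix.head_cons]

/-- The three cells are off the printed triple (the slot is DISPLAYED, not discharged, on them — except `b*`, whose
discharge is S-E-p6-2). [cite: Zhang2022LandauSiegel, §2 (2.13)] -/
theorem bD1_ne_std : bD1Star ≠ ![1, 2, 3] ∧ bD1FirstGap ≠ ![1, 2, 3] ∧ bD1TopGap ≠ ![1, 2, 3] := by
  refine ⟨fun h => ?_, fun h => ?_, fun h => ?_⟩
  · have h0 := congr_fun h 0
    norm_num [bD1Star] at h0
  · have h0 := congr_fun h 0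
    norm_num [bD1FirstGap] at h0
  · have h0 := congr_fun h 0
    norm_num [bD1TopGap] at h0

end Det

namespace Repair

open Det KnifeEdge

/-! ### Part 1 — the design type of DET ∩ (landed rows), class and verdict -/

/-- **Designs of the killed class DET that a landed `R⁺⁺` row covers** (module docstring table), one constructor per
covered sub-class: `w2 d` — a sign-admissible shift detector `b` (W1 ∪ W2) with the two one-sided legs `(u, f)` it is
run against (`Repair.DetShiftDesign`); `stdLegs g g′ f f′` — the PRINTED detector against any pair of `H¹` one-sided
legs; `w1calc θ` — the PRINTED detector on the glued calculus-class design `θ`. (General-weight (a)-members,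
sign-indefinite members, two-sided legs at general `b`: NO constructor — u-items (u1)–(u3).)
[cite: Zhang2022LandauSiegel, §2 (2.13), Lemma 2.3, (2.32)–(2.33); §7 Prop 7.1 (7.2)] -/
inductive BdetDesign : Type
  | w2 (d : DetShiftDesign)
  | stdLegs (g g' f f' : ℝ → ℂ)
  | w1calc (θ : Theta)

/-- **Membership** = the covering family's class (NO analytic hypothesis, no slot inside): `w2`:
`Det.SignAdmissible d.b ∧ Det.InShiftBox d.b ∧` one-sided kinked legs `u(1) = 0 = f(1)`; `stdLegs`: both legs `H¹` on
`[0,1]` AND `g(1) = f(1) = 0` (guard G1 stated: the 𝔅-currency dictionary region); `w1calc`: `AdmissibleThetaCalc θ`.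
[cite: Zhang2022LandauSiegel, §2 (2.13), Lemma 2.3, (2.32)–(2.33); §7 Prop 7.1 (7.2)] -/
def KBdet : BdetDesign → Prop
  | .w2 d => familyDetShift.InClass d
  | .stdLegs g g' f f' => IsH1OnUnitInterval g g' ∧ IsH1OnUnitInterval f f' ∧ g 1 = 0 ∧ f 1 = 0
  | .w1calc θ => familyRCalc.InClass θ

/-- **The verdict «no main-order closing without an input outside DET»**, sub-class by sub-class = the covering family's
verdict with its slot DISPLAYED there: `w2`: `Det.FormDetPSD (Det.shiftRecipe b) → ¬ (𝔅_b(u)·𝔅_b(f) < ‖P_b(u,f)‖²)`;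
`stdLegs`: `¬ (𝔅(g)·𝔅(f) < ‖P(g,f)‖²)`; `w1calc`: `¬ (C₂₃₂(θ)·C₂₃₃(θ) < |𝔡+𝔡′|²(θ))`.
[cite: Zhang2022LandauSiegel, §2 (2.18), Props. 2.4–2.6, (2.32)–(2.33); §7 Prop 7.1 (7.2)] -/
def VBdet : BdetDesign → Prop
  | .w2 d => familyDetShift.Verdict d
  | .stdLegs g g' f f' => familyH1.Verdict (g, g', f, f')
  | .w1calc θ => familyRCalc.Verdict θ

/-- **The covered part of DET as ONE family** `familyBdet = ⟨BdetDesign, KBdet, VBdet⟩`.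
[cite: Zhang2022LandauSiegel, §2 (2.32)–(2.33); §7 Prop 7.1 (7.2)] -/
def familyBdet : DesignFamily where
  Design := BdetDesign
  InClass := KBdet
  Verdict := VBdet

/-- **`familyBdet` IS DECIDED** — by cases, from the landed terms (nothing re-proved).
[cite: Zhang2022LandauSiegel, §2 (2.32)–(2.33); §7 Prop 7.1 (7.2)] -/
theorem familyBdet_decided : familyBdet.Decided
  | .w2 d, h => familyDetShift_decided d h
  | .stdLegs g g' f f', h => not_repairable_in_Rplus (.hOne g g' f f') ⟨h.1, h.2.1⟩
  | .w1calc θ, h => familyRCalc_decided θ h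

/-- **`R⁺ ++ [familyBdet]` is decided** (`Repair.rplus_extend`). [cite: Zhang2022LandauSiegel, §2 (2.32)–(2.33)] -/
theorem rplus_bdet_decided : ClassDecided (Rplus ++ [familyBdet]) :=
  rplus_extend familyBdet_decided

/-! ### Part 2 — the word as a LIST of its covering families (v1 = the three landed rows) -/

/-- **The word's covering families, v1** (rows 17, 2, 6 of the class of record `Repair.Rplusplus4`).
[cite: Zhang2022LandauSiegel, §2 (2.32)–(2.33); §7 Prop 7.1 (7.2)] -/
def bdetWord : List DesignFamily := [familyDetShift, familyH1, familyRCalc]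

/-- **The word's families are decided.** [cite: Zhang2022LandauSiegel, §2 (2.32)–(2.33); §7 Prop 7.1 (7.2)] -/
theorem bdetWord_decided : ClassDecided bdetWord :=
  classDecided_cons familyDetShift_decided <|
    classDecided_cons (fun p h => not_repairable_in_Rplus (.hOne p.1 p.2.1 p.2.2.1 p.2.2.2) h) <|
      classDecided_cons familyRCalc_decided classDecided_nil

/-- **`R⁺ ++ bdetWord` is decided.** [cite: Zhang2022LandauSiegel, §2 (2.32)–(2.33)] -/
theorem rplus_bdetWord_decided : ClassDecided (Rplus ++ bdetWord) :=
  classDecided_append.2 ⟨rplus_decided, bdetWord_decided⟩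

/-- The families of the word, by name. [cite: Zhang2022LandauSiegel, §2 (2.32)–(2.33)] -/
theorem mem_bdetWord_iff (F : DesignFamily) :
    F ∈ bdetWord ↔ F = familyDetShift ∨ F = familyH1 ∨ F = familyRCalc := by
  simp only [bdetWord, List.mem_cons, List.not_mem_nil, or_false]

/-! ### Part 3 — C2 by term: each constructor IS its family; the printed triple embeds into `stdLegs` -/

/-- Each constructor IS its family (class and verdict by `Iff.rfl`). [cite: Zhang2022LandauSiegel, §2 (2.32)–(2.33); §7 Prop 7.1 (7.2)] -/
theorem kbdet_rows_iff (d : DetShiftDesign) (g g' f f' : ℝ → ℂ) (θ : Theta) :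
    (KBdet (.w2 d) ↔ d.InClass) ∧ (VBdet (.w2 d) ↔ d.Verdict) ∧
      (KBdet (.w1calc θ) ↔ AdmissibleThetaCalc θ) ∧
      (VBdet (.w1calc θ) ↔ ¬ (C232S θ * C233T θ < ‖dSumS θ‖ ^ 2)) ∧
      (VBdet (.stdLegs g g' f f') ↔
        ¬ (mainTermForm g g' * mainTermForm f f' < ‖mainTermFormPolar g g' f f'‖ ^ 2)) :=
  ⟨Iff.rfl, Iff.rfl, Iff.rfl, Iff.rfl, Iff.rfl⟩

/-- The `w2` verdict with its slot DISPLAYED (kind (c), registry E-010; asserted nowhere):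
`FormDetPSD (shiftRecipe b) → ¬ (𝔅_b(u)·𝔅_b(f) < ‖P_b(u,f)‖²)`. [cite: Zhang2022LandauSiegel, §2 (2.18), (2.32)–(2.33)] -/
theorem vbdet_w2_iff (d : DetShiftDesign) :
    VBdet (.w2 d) ↔
      (FormDetPSD (shiftRecipe d.b) →
        ¬ (FormDet (shiftRecipe d.b) d.u d.u' * FormDet (shiftRecipe d.b) d.f d.f'
            < ‖FormDetPolar (shiftRecipe d.b) d.u d.u' d.f d.f'‖ ^ 2)) :=
  Iff.rfl

/-- **C2.** A `w2` member at the PRINTED triple `b = (1,2,3)` is a `stdLegs` member with the SAME verdict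
(`Repair.detShift_std_toH1`: kinked ⇒ `H¹`; `𝔅_std = 𝔅`, `P_std = P`, slot discharged).
[cite: Zhang2022LandauSiegel, §2 (2.18), (2.32)–(2.33); §7 Prop 7.1 (7.2)] -/
theorem kbdet_w2_std (d : DetShiftDesign) (h : KBdet (.w2 d)) (hb : d.b = ![1, 2, 3]) :
    KBdet (.stdLegs d.u d.u' d.f d.f') ∧ (VBdet (.w2 d) ↔ VBdet (.stdLegs d.u d.u' d.f d.f')) := by
  have h' : d.InClass := h
  obtain ⟨hH1, hiff⟩ := detShift_std_toH1 d h' hb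
  obtain ⟨-, -, -, hu1, -, hf1⟩ := h'
  exact ⟨⟨hH1.1, hH1.2, hu1, hf1⟩, hiff⟩

/-- … and at the printed triple the displayed slot HOLDS (`Det.formDetPSD_shiftRecipe_std`), so the `w2` verdict there
reads outright in 𝔅-currency. [cite: Zhang2022LandauSiegel, §2 (2.18), (2.32)–(2.33)] -/
theorem vbdet_w2_std_iff {u u' f f' : ℝ → ℂ} (hu : KinkedProfile u u') (hf : KinkedProfile f f') (hu1 : u 1 = 0)
    (hf1 : f 1 = 0) :
    VBdet (.w2 ⟨![1, 2, 3], u, u', f, f'⟩) ↔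
      ¬ (mainTermForm u u' * mainTermForm f f' < ‖mainTermFormPolar u u' f f'‖ ^ 2) :=
  detShift_std_verdict_iff hu hf hu1 hf1

/-- EMBEDDINGS: every class-`R` design `θ` is a `w1calc` member (`AdmissibleTheta.toCalc`), and its `𝔡`- and
`𝔡′`-block legs are `w2` members for EVERY sign-admissible `b` in the box (`Repair.inClass_dLeg` / `inClass_dPrimeLeg`).
[cite: Zhang2022LandauSiegel, §2 (2.13), (2.21)–(2.28); §10 (10.1)] -/
theorem kbdet_of_admissible {θ : Theta} (hθ : AdmissibleTheta θ) {b : Fin 3 → ℝ}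
    (hb : SignAdmissible b ∧ InShiftBox b) :
    KBdet (.w1calc θ) ∧ KBdet (.w2 (dLeg b θ)) ∧ KBdet (.w2 (dPrimeLeg b θ)) :=
  ⟨hθ.toCalc, inClass_dLeg hb hθ.toCalc, inClass_dPrimeLeg hb hθ.toCalc⟩

/-! ### Part 4 — C4: the class is inhabited by the word's named members (det-D1-B) -/

/-- **C4 (members from det-D1-B.json f36f1400289c2177).** The control cell `det-W1-1;2,3` — the printed detector on the
printed design's `𝔡`/`𝔡′`-block legs (`w2`, slot discharged), on the printed one-sided legs as `H¹` pairs (`stdLegs`),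
and on the glued printed design `θ₀` (`w1calc`); the W2 cells `det-W2-1/2;2,5/2` (`Det.bD1Star`, the S-E-p6-2 certificate
point), `det-W2-1/4;1/2,3/4` (`Det.bD1FirstGap`), `det-W2-3/4;3,4` (`Det.bD1TopGap`) with the printed legs of `θ₀`;
`g⋆` against itself (`stdLegs`). [cite: Zhang2022LandauSiegel, §2 (2.13), (2.21)–(2.28); §7 Prop 7.1 (7.2); §10 (10.1)] -/
theorem kbdet_inhabited :
    KBdet (.w2 (dLeg ![1, 2, 3] theta0)) ∧ KBdet (.w2 (dPrimeLeg ![1, 2, 3] theta0)) ∧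
      KBdet (.w2 (dLeg bD1Star theta0)) ∧ KBdet (.w2 (dPrimeLeg bD1Star theta0)) ∧
      KBdet (.w2 (dLeg bD1FirstGap theta0)) ∧ KBdet (.w2 (dLeg bD1TopGap theta0)) ∧
      KBdet (.stdLegs (h1Profile theta0) (h1Profile' theta0) (tentT theta0) (tentT' theta0)) ∧
      KBdet (.stdLegs gStar gStar' gStar gStar') ∧
      KBdet (.w1calc theta0) :=
  ⟨inClass_dLeg ⟨signAdmissible_std, inShiftBox_std⟩ admissible_theta0.toCalc,
    inClass_dPrimeLeg ⟨signAdmissible_std, inShiftBox_std⟩ admissible_theta0.toCalc,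
    inClass_dLeg signAdmissible_bD1Star admissible_theta0.toCalc,
    inClass_dPrimeLeg signAdmissible_bD1Star admissible_theta0.toCalc,
    inClass_dLeg signAdmissible_bD1FirstGap admissible_theta0.toCalc,
    inClass_dLeg signAdmissible_bD1TopGap admissible_theta0.toCalc,
    ⟨(kinkedProfile_h1Profile_calc admissible_theta0.toCalc).isH1,
      (kinkedProfile_tentT admissible_theta0.toCalc.2.2.1).isH1, h1Profile_one_calc admissible_theta0.toCalc,
      tentT_one_calc admissible_theta0.toCalc⟩,
    ⟨inClassPiece_gStar.kinked.isH1, inClassPiece_gStar.kinked.isH1, inClassPiece_gStar.vanish 1 le_rfl,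
      inClassPiece_gStar.vanish 1 le_rfl⟩,
    admissible_theta0.toCalc⟩

/-- **The verdicts at the printed triple in the record's functionals** (pointers, one term each): `𝔡`-block
`¬ (Re 𝔠₁T·C233T < |𝔡|²)`, `𝔡′`-block `¬ (C233T(θ.reflectJ)·Re 𝔠₂T < |𝔡′|²)` (`Repair.detShift_std_dLeg_verdict` /
`…dPrimeLeg…`, family `w2`, slot discharged), glued `¬ (C₂₃₂·C₂₃₃ < |𝔡+𝔡′|²)` (family `w1calc`) — for every
calculus-class `θ`. [cite: Zhang2022LandauSiegel, §2 (2.18), (2.32)–(2.33); §10 (10.1)] -/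
theorem bdet_std_verdicts {θ : Theta} (hθ : AdmissibleThetaCalc θ) :
    ¬ ((frakc1T θ).re * C233T θ < ‖dSum1S θ‖ ^ 2) ∧
      ¬ (C233T θ.reflectJ * (frakc2T θ).re < ‖dSum2S θ‖ ^ 2) ∧
      ¬ (C232S θ * C233T θ < ‖dSumS θ‖ ^ 2) :=
  ⟨detShift_std_dLeg_verdict hθ, detShift_std_dPrimeLeg_verdict hθ, familyRCalc_decided θ hθ⟩

/-- **The slot at the printed triple is a theorem** (`Det.formDetPSD_shiftRecipe_std`); off `(1,2,3)` it is DISPLAYED in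
`VBdet (.w2 _)` and asserted nowhere in this file (per-`b` discharges: S-E-p6-2). [cite: Zhang2022LandauSiegel, Prop 7.1 with (8.11)–(8.23), pp.44–50] -/
theorem bdet_slot_std : FormDetPSD (shiftRecipe ![1, 2, 3]) := formDetPSD_shiftRecipe_std

/-- **The §2 final-step shape on a `w2` member, under the slot**: bounds `𝔅_b(u) ≤ q` ((2.32)-type), `𝔅_b(f) ≤ c_J`
((2.33)-type), `dd ≤ ‖P_b(u,f)‖` (Prop. 2.4-type) never give `√(q·c_J) < dd` (`Repair.not_sqrt_closing_detShift`).
[cite: Zhang2022LandauSiegel, §2 (2.18), Props. 2.4–2.6 p.6, (2.32)–(2.33)] -/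
theorem bdet_w2_not_sqrt_closing (d : DetShiftDesign) (h : KBdet (.w2 d)) (hpsd : FormDetPSD (shiftRecipe d.b))
    {q cJ dd : ℝ} (hq : FormDet (shiftRecipe d.b) d.u d.u' ≤ q) (hcJ : FormDet (shiftRecipe d.b) d.f d.f' ≤ cJ)
    (hd : dd ≤ ‖FormDetPolar (shiftRecipe d.b) d.u d.u' d.f d.f'‖) : ¬ (Real.sqrt (q * cJ) < dd) :=
  not_sqrt_closing_detShift d h hpsd hq hcJ hd

/-! ### Part 5 — v2: the ENTANGLED sub-class (widened clause (i′)) joins — `bdetWord2 := bdetWord ++ [familyDetEntangled]`;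
the `w2` row's slot is a THEOREM at `b⋆ = (1/2; 2, 5/2)` as well as at `(1,2,3)`

Writer of this Part: ls-Bdet-typer-2 g2 (INTAKE-4 co-owner; §E RULING 2026-08-26T23:22:50Z «v2», GO (B) 23:38:57Z); v1's
declarations above are UNCHANGED. C1 unchanged (the word 23:09:45Z, the RE-SAID §1a clause 23:27:01Z and the §2 class text
quoted VERBATIM above; certificate KILL-CERT(B-det) v2.1). Row text updates for the assembly and the bundle:

* `Repair.familyDetShift` (`w2`; p460173): «CONDITIONAL on E-010 off {(1,2,3), (1/2; 2, 5/2)}; at those two triples the slot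
  `Det.FormDetPSD (Det.shiftRecipe b)` is a tree theorem — `Det.formDetPSD_shiftRecipe_std`, `Det.formDetPSD_shiftRecipe_bStar`
  (RepairDetShiftPSD.lean, p473995; `Repair.detShift_unconditional_bStar`)» — in this file: `bdet_slot_bStar`, `vbdet_w2_bStar`.
* NEW ROW `Repair.familyDetEntangled` (RepairDetEntangled.lean, p475645): the ENTANGLED class-DET detectors of clause (i′) —
  `Σ_ρ (iM′)²α³·x_a·|Σ_j x_jA_{h_j}|²·ω`, anchor `a ∈ (0,1)`, finite palette `b_j ∈ (0,5)`, one-sided kinked top-vanishing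
  profiles (NO analytic hypothesis); block-form currency `Det.entangledMain a b h h′ = hᵀ·BigF(a;b)·h` (DetectorEntangledCone.lean,
  p473997; derivation E-010(i) + repeated-shift rule + E-080 not asserted); verdict `¬ (Re m < 0)` GIVEN the E-102 MEMBER
  `Det.ConePSD a b` (displayed, kind (c)) — **CONDITIONAL GIVEN E-102**; the row of record `Det.EdetCone (Set.Ioo 0 1) (Set.Ioo 0 5)`
  discharges every member's slot (`Repair.detEntangled_verdict_of_edetCone`, here `vbdet2_entangled_of_edetCone`); coverage counted
  once (K = 1 members = repeated monomials `X_a·X_x²`; SOS cells = det-D2⁺ rows); NO member's block matrix is certified PSD by a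
  theorem of this tree — per member the cell's numerics decide (KILL-CERT §7 T10), the continuum is E-102 itself.

`Repair.BdetDesign2` = v1's designs (`ofV1`) + `entangled (d : Repair.DetEntangledDesign)`; `KBdet2`/`VBdet2`/`familyBdet2`
dispatch to the rows; `familyBdet2_decided` by cases (nothing re-proved); `bdetWord2`, `bdetWord2_decided`, `mem_bdetWord2_iff`
(for the assembly: class of record `Repair.Rplusplus12` p477072 carries `rplusplus12_words_sub` / `bdetWord_sub_rplusplus12` for v1 and
row 40 = `familyDetEntangled`; `bdetWord2_sub_rplusplus12` (or `…13`) is ls-barrier-p1's addendum). C4 for `entangled`: the scanned det-D2⁺ SOS cells `(½; 2, 3; t = 1)` and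
`(¼; ½, ¾; t = 1)` on the linear profile and `(½; 2, 3; t = ¼)` on the printed leg `g₁ = h1Profile θ₀` (`kbdet2_entangled_witnesses`).
Still NO constructor (u-items, unchanged from v1): general-weight (a)-members beyond shift detectors and entangled squares,
sign-indefinite members (no valid endgame — desk), two-sided legs at general `b`, the door (det-E6/E-097) and every design
reading the family beyond length `P`. FRAMING: the programme SEARCHES and TYPES; KILL(B-det) says the det design space as scanned
contains no repair of the §18 margin, GIVEN E-102; no claim about Landau–Siegel zeros, Theorems 1–2 of arXiv:2211.02515 or a
repaired Margin232 follows. -/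

/-- **The word's covering families, v2** = v1 ++ `[familyDetEntangled]`. [cite: Zhang2022LandauSiegel, §2 (2.32)–(2.33); §7 Prop 7.1 (7.2)] -/
def bdetWord2 : List DesignFamily := bdetWord ++ [familyDetEntangled]

/-- **v2 is decided** (`bdetWord_decided`, `familyDetEntangled_decided`). [cite: Zhang2022LandauSiegel, §2 (2.32)–(2.33)] -/
theorem bdetWord2_decided : ClassDecided bdetWord2 :=
  classDecided_append.2 ⟨bdetWord_decided, classDecided_cons familyDetEntangled_decided classDecided_nil⟩

/-- `R⁺ ++ bdetWord2` is decided. [cite: Zhang2022LandauSiegel, §2 (2.32)–(2.33)] -/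
theorem rplus_bdetWord2_decided : ClassDecided (Rplus ++ bdetWord2) :=
  classDecided_append.2 ⟨rplus_decided, bdetWord2_decided⟩

/-- v1 is a prefix of v2. [cite: Zhang2022LandauSiegel, §2 (2.32)–(2.33)] -/
theorem bdetWord_sub_bdetWord2 : ∀ F ∈ bdetWord, F ∈ bdetWord2 :=
  fun _ hF => List.mem_append.2 (Or.inl hF)

/-- The families of v2, by name. [cite: Zhang2022LandauSiegel, §2 (2.32)–(2.33)] -/
theorem mem_bdetWord2_iff (F : DesignFamily) :
    F ∈ bdetWord2 ↔ F = familyDetShift ∨ F = familyH1 ∨ F = familyRCalc ∨ F = familyDetEntangled := by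
  simp only [bdetWord2, bdetWord, List.cons_append, List.nil_append, List.mem_cons, List.not_mem_nil, or_false]

/-- **Designs of the covered part of DET, v2**: v1 plus `entangled` (`Repair.DetEntangledDesign`: anchor, finite palette,
profile vector). [cite: Zhang2022LandauSiegel, §2 (2.13), (2.15)–(2.16), (2.32)–(2.33); §7 Prop 7.1 (7.2)] -/
inductive BdetDesign2 : Type
  | ofV1 (d : BdetDesign)
  | entangled (d : DetEntangledDesign)

/-- Membership, v2 (`entangled`: `0 < a < 1`, `0 < b_j < 5`, one-sided kinked top-vanishing profiles; NO analytic hypothesis).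
[cite: Zhang2022LandauSiegel, §2 (2.13), Lemma 2.3, (2.32)–(2.33); §7 Prop 7.1 (7.2)] -/
def KBdet2 : BdetDesign2 → Prop
  | .ofV1 d => KBdet d
  | .entangled d => familyDetEntangled.InClass d

/-- Verdict, v2 (`entangled`: `Det.ConePSD d.a d.b → ¬ (Re Det.entangledMain d.a d.b d.h d.h′ < 0)`, the E-102 member DISPLAYED).
[cite: Zhang2022LandauSiegel, §2 (2.16), (2.18), (2.32)–(2.33); §7 Prop 7.1 (7.2)] -/
def VBdet2 : BdetDesign2 → Prop
  | .ofV1 d => VBdet d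
  | .entangled d => familyDetEntangled.Verdict d

/-- **The covered part of DET as one family, v2.** [cite: Zhang2022LandauSiegel, §2 (2.32)–(2.33); §7 Prop 7.1 (7.2)] -/
def familyBdet2 : DesignFamily where
  Design := BdetDesign2
  InClass := KBdet2
  Verdict := VBdet2

/-- **v2 is decided** — by cases (nothing re-proved). [cite: Zhang2022LandauSiegel, §2 (2.32)–(2.33); §7 Prop 7.1 (7.2)] -/
theorem familyBdet2_decided : familyBdet2.Decided
  | .ofV1 d, h => familyBdet_decided d h
  | .entangled d, h => familyDetEntangled_decided d h

/-- `R⁺ ++ [familyBdet2]` is decided. [cite: Zhang2022LandauSiegel, §2 (2.32)–(2.33)] -/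
theorem rplus_bdet2_decided : ClassDecided (Rplus ++ [familyBdet2]) :=
  rplus_extend familyBdet2_decided

/-- v1 embeds into v2 unchanged; the `entangled` term IS its family's row (class and verdict by `Iff.rfl`).
[cite: Zhang2022LandauSiegel, §2 (2.32)–(2.33); §7 Prop 7.1 (7.2)] -/
theorem kbdet2_ofV1_iff (d : BdetDesign) (e : DetEntangledDesign) :
    (KBdet2 (.ofV1 d) ↔ KBdet d) ∧ (VBdet2 (.ofV1 d) ↔ VBdet d) ∧
      (KBdet2 (.entangled e) ↔ e.InClass) ∧ (VBdet2 (.entangled e) ↔ e.Verdict) :=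
  ⟨Iff.rfl, Iff.rfl, Iff.rfl, Iff.rfl⟩

/-- The `entangled` verdict with its slot DISPLAYED (kind (c), registry E-102 member; asserted nowhere):
`ConePSD a b → ¬ (Re m(a;b;h) < 0)`. [cite: Zhang2022LandauSiegel, §2 (2.16), (2.32)–(2.33)] -/
theorem vbdet2_entangled_iff (e : DetEntangledDesign) :
    VBdet2 (.entangled e) ↔ (ConePSD e.a e.b → ¬ ((entangledMain e.a e.b e.h e.h').re < 0)) :=
  Iff.rfl

/-- **GIVEN THE ROW E-102** (`Det.EdetCone (Set.Ioo 0 1) (Set.Ioo 0 5)`) every `entangled` member's verdict holds with the slot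
discharged: `¬ (Re m < 0)` (`Repair.detEntangled_verdict_of_edetCone`). [cite: Zhang2022LandauSiegel, §2 (2.16), (2.32)–(2.33)] -/
theorem vbdet2_entangled_of_edetCone (hE : EdetCone (Set.Ioo 0 1) (Set.Ioo 0 5)) (e : DetEntangledDesign)
    (h : KBdet2 (.entangled e)) : ¬ ((entangledMain e.a e.b e.h e.h').re < 0) :=
  detEntangled_verdict_of_edetCone hE e h

/-- **C4 for `entangled`** (members from the det-D2⁺ scan, B-det/designs/det-D2plus-*.json / cone-D2plus.json c5cad45e214f89eb):
the SOS cells `(½; 2, 3; t = 1)` (`Repair.sosCellHalf23`) and `(¼; ½, ¾; t = 1)` on the linear profile `1 − y`, and `(½; 2, 3; t = ¼)`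
on the printed leg `g₁ = h1Profile θ₀`. [cite: Zhang2022LandauSiegel, §2 (2.13), (2.15); §7 Prop 7.1 (7.2); §10 (10.1)] -/
theorem kbdet2_entangled_witnesses :
    KBdet2 (.entangled sosCellHalf23) ∧
      KBdet2 (.entangled (sosCell (1 / 4) (1 / 2) (3 / 4) 1 linProfile linProfile')) ∧
      KBdet2 (.entangled (sosCell (1 / 2) 2 3 (1 / 4) (h1Profile theta0) (h1Profile' theta0))) :=
  ⟨inClass_sosCellHalf23,
    inClass_sosCell (by norm_num) (by norm_num) (by norm_num) kinkedProfile_lin linProfile_one,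
    inClass_sosCell (by norm_num) (by norm_num) (by norm_num) (kinkedProfile_h1Profile_calc admissible_theta0.toCalc)
      (h1Profile_one_calc admissible_theta0.toCalc)⟩

/-- The `entangled` verdict on the printed-leg SOS cell, spelled in recipe values (`Repair.verdict_sosCell`): GIVEN the pair member
`ConePSD (1/2) (2,3)`, `¬ (F(½,2,2)(g₁) − 2t·F(½,2,3)(g₁) + t²·F(½,3,3)(g₁) < 0)` at `t = ¼`.
[cite: Zhang2022LandauSiegel, §2 (2.16), (2.32); §7 Prop 7.1 (7.2)] -/
theorem vbdet2_entangled_printedLeg (hP : ConePSD (1 / 2 : ℝ) ![(2 : ℝ), 3]) :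
    ¬ (FormDetDD ![1 / 2, 2, 2] (h1Profile theta0) (h1Profile' theta0)
        - 2 * (1 / 4) * FormDetDD ![1 / 2, 2, 3] (h1Profile theta0) (h1Profile' theta0)
        + (1 / 4) ^ 2 * FormDetDD ![1 / 2, 3, 3] (h1Profile theta0) (h1Profile' theta0) < 0) :=
  verdict_sosCell kbdet2_entangled_witnesses.2.2 hP

/-- v1 members are v2 members (every `kbdet_inhabited` term, and every det-D1-B cell's legs via `Repair.inClass_d1Cells_theta0`,
RepairDetShiftMembers.lean p470739). [cite: Zhang2022LandauSiegel, §2 (2.13), (2.21)–(2.28); §7 Prop 7.1 (7.2)] -/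
theorem kbdet2_ofV1_d1Cells :
    ∀ t ∈ d1Cells, KBdet2 (.ofV1 (.w2 (dLeg (quarterTriple t.1 t.2.1 t.2.2) theta0))) ∧
      KBdet2 (.ofV1 (.w2 (dPrimeLeg (quarterTriple t.1 t.2.1 t.2.2) theta0))) :=
  fun t ht => inClass_d1Cells_theta0 t ht

/-! #### The `w2` row at `b⋆ = (1/2; 2, 5/2)`: slot discharged in tree (p473995) -/

/-- `Det.bD1Star` IS the certificate point `Det.bStar`. [cite: Zhang2022LandauSiegel, §2 (2.13)] -/
theorem bD1Star_eq_bStar : bD1Star = bStar := rfl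

/-- **The slot at `b⋆` is a theorem** (`Det.formDetPSD_shiftRecipe_bStar`, RepairDetShiftPSD.lean p473995): the `w2` row reads
«CONDITIONAL on E-010 off {(1,2,3), (1/2;2,5/2)}». [cite: Zhang2022LandauSiegel, §7 Prop. 7.1 p.44; §2 (2.16), Lemma 2.3] -/
theorem bdet_slot_bStar : FormDetPSD (shiftRecipe bD1Star) := formDetPSD_shiftRecipe_bStar

/-- **Every `w2` member with `b = b⋆` satisfies its verdict's conclusion OUTRIGHT** (`Repair.detShift_unconditional_bStar`):
`¬ (𝔅_{b⋆}(u)·𝔅_{b⋆}(f) < ‖P_{b⋆}(u,f)‖²)`. [cite: Zhang2022LandauSiegel, §2 (2.18), Props. 2.4–2.6, (2.32)–(2.33)] -/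
theorem vbdet_w2_bStar (d : DetShiftDesign) (h : KBdet (.w2 d)) (hb : d.b = bD1Star) :
    ¬ (FormDet (shiftRecipe d.b) d.u d.u' * FormDet (shiftRecipe d.b) d.f d.f'
        < ‖FormDetPolar (shiftRecipe d.b) d.u d.u' d.f d.f'‖ ^ 2) :=
  detShift_unconditional_bStar d h hb


/-! #### GIVEN the FULL premise E-102 (`Det.EdetPremise`, DetectorEntangledCone.lean Part 5, p476440): every displayed slot
of v2 is discharged -/

/-- **GIVEN E-102 IN FULL** — `Det.EdetPremise (Set.Ioo 0 1) (Set.Ioo 0 5)` = entangled cone ∧ monomial cone, the word's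
premise «det-E15 E-det-cone on the continuum» as typed per REF-B1 rider F-E102-1 — every `w2` member's recipe slot
`FormDetPSD (shiftRecipe b)` and every `entangled` member's block slot `ConePSD a b` hold, so BOTH conditional rows of
`bdetWord2` read OUTRIGHT: `familyDetShift`: `¬ (𝔅_b(u)·𝔅_b(f) < ‖P_b(u,f)‖²)`; `familyDetEntangled`: `¬ (Re m < 0)`.
This is how qualifier (b) of the word («unconditional when E-102's discharge is ACCEPTED») types: a proof of
`Det.EdetPremise (Set.Ioo 0 1) (Set.Ioo 0 5)` makes `familyBdet2`'s conditional verdicts hypothesis-free. Nothing here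
proves the premise. [cite: Zhang2022LandauSiegel, §2 (2.16), (2.18), (2.32)–(2.33); §7 Prop 7.1 (7.2)] -/
theorem bdet2_verdicts_of_edetPremise (hE : EdetPremise (Set.Ioo 0 1) (Set.Ioo 0 5)) :
    (∀ d : DetShiftDesign, KBdet (.w2 d) →
        ¬ (FormDet (shiftRecipe d.b) d.u d.u' * FormDet (shiftRecipe d.b) d.f d.f'
            < ‖FormDetPolar (shiftRecipe d.b) d.u d.u' d.f d.f'‖ ^ 2)) ∧
      ∀ e : DetEntangledDesign, KBdet2 (.entangled e) → ¬ ((entangledMain e.a e.b e.h e.h').re < 0) :=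
  ⟨fun d h => not_repairable_detShift d h (hE.formDetPSD h.1 fun j => h.2.1 j),
    fun e h => detEntangled_verdict_of_edetCone hE.edetCone e h⟩

/-- **The slots of v2 are load-bearing exactly where displayed**: off `{(1,2,3), b⋆}` the `w2` verdict and everywhere the
`entangled` verdict are IMPLICATIONS from their displayed members (`Iff.rfl`), decided nowhere in this file.
[cite: Zhang2022LandauSiegel, §2 (2.32)–(2.33)] -/
theorem bdet2_slots_displayed (d : DetShiftDesign) (e : DetEntangledDesign) :
    (VBdet2 (.ofV1 (.w2 d)) ↔ (FormDetPSD (shiftRecipe d.b) →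
        ¬ (FormDet (shiftRecipe d.b) d.u d.u' * FormDet (shiftRecipe d.b) d.f d.f'
            < ‖FormDetPolar (shiftRecipe d.b) d.u d.u' d.f d.f'‖ ^ 2))) ∧
      (VBdet2 (.entangled e) ↔ (ConePSD e.a e.b → ¬ ((entangledMain e.a e.b e.h e.h').re < 0))) :=
  ⟨Iff.rfl, Iff.rfl⟩


/-! ### Part 6 — docstring ERRATUM (REF-E INTAKE-4 verdict 45, NOTE N1, ls-barrier-ref g2 2026-08-27T00:30:47Z (2);
ls-barrier-plan g1 00:34:23Z (2)): the class text §2 of KILL-CERT(B-det) IN FULL — no declaration is touched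

The module docstring's «§2 (a) «The class DET as conjuncts» (… verbatim core …)» block ABRIDGES chunk (ii) of the class text
(it omits the ALL-PATTERNS reading parenthesis and the E-det-5 / E-det-2 / E-det-6 tags; REF-E: «touches only the
(b)-READING of W3 cells (u2), no typed predicate»). For the record, here is §2 «(a) The class DET as conjuncts» of
B-det/KILL-draft.md = KILL-CERT(B-det) v2.2 sha16 07ec14efd7c91255 (§2 byte-identical in v2.0 547cbfcd828e180c / v2.1
dc2c2f0e9b79566b / v2.2), VERBATIM (whitespace re-wrapped only), clauses (i)–(iv) with the STRUCTURAL SENTENCE and the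
widening (i′); everywhere the header above says «verbatim core», THIS block is the text of record:

«(i) sampling Σ ∈ {Σ₁ = 𝔷(ψ) (`Skeleton.zeroSet`), Σ₂ = zeros of L(ψ)L(ψχ) in Ω (`prodZeroSetOmega`)}; family ∈ {Ψ₁, Ψ}
with amplifier a(ψ) ≥ 0 (`DETDesign.amp_nonneg`); (ii) weight w_d(ρ,ψ) = c₀·a(ψ)·(P₀(M(ρ+β_•)) +
P₁(M(ρ+β_•))/M′(ρ))·ω(ρ), k ≤ 3 shifts β_j = i b_j α(1 + e_j c′α𝓛), b_j ∈ (0,5), P₀, P₁ of total degree ≤ 3 —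
SIGN-INDEFINITE weights allowed («admissible»/«sign-indefinite» are read under the ALL-PATTERNS law of the fence:
sign-uniform over all local zero patterns; pattern law = theory g1 (c4), REF-B2 det n1) (W1 printed, W2 admissible =
`Det.SignAdmissible` ⇔ lattice-symbol test `Det.signAdmissible_iff_latticeSymbolNonpos` p465818 with
`signRobust_of_signAdmissible` p464997 discharging E-086's sign input (for the printed perturbation pattern e =
(−1,1,−1) — E-det-5), W3 non-admissible, W4-type affine weights all inside; for general (P₀,P₁,e,a) members the
(a)/(b) membership is read off the member's own lattice symbol — E-det-2; the evaluated W3 cells' (b)-membership is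
read under the all-patterns occupancy law ((c4) theory g1), parity census 474 robust / 200 even-admissible / 78
odd-admissible INDEFINITE (REF-B1 e6a546b1f48eeadd) — E-det-6); (iii) support ≤ 2: one sesquilinear statistic per
sample, test side = any coefficient pair admissible in the sense (7.2) (`Skeleton.Adm72`: lengths < P/T², ℓ = 1)
through `DetTemplate.Detector.pairMean`; (iv) endgame = a CONFIGURATION-VALID inequality among finitely many displayed
means (`Det.ConfigValid`; linear + Gram statistics: `Det.ConfigValidOn` — CS, POS, Gram minors, Turán-type, one-sided,
counts; REF-B1 r1); an endgame that is not a universally valid inequality is OUTSIDE DET (§8 e5). STRUCTURAL SENTENCE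
(D6-DOOR §8; ls-ref-1 20:14:50Z): «test lengths ≤ P (exact ψ-orthogonality) is ALSO what makes the exceptional set Ψ₂
affordable with trivial bounds; any detector reading the family beyond length P must price Ψ₂ pointwise (det-E10 =
E-097 `Det.EdetPsi2`) — the charter's E*-len-strength input in family currency». OUTSIDE DET by construction (named,
not swept): §8 EXITS e1–e6.
(i′) CLASS WIDENING OF RECORD (REF-B1 R-d2p-2, 22:09:15Z; a linearity widening, no new analytic input): the weight
clause (ii) reads «P₀, P₁ = real cubic FORMS in ANY finite number K of shifted M-values M(ρ+iαb_j), b_j ∈ (0,5), j =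
1…K — each monomial involves ≤ 3 shifts (automatic for degree ≤ 3)»; the typed DATA `Det.DETDesign k` (k ≤ 3) and the
quantifier of `Det.ModelBarrier` (∀ k ≤ 3) are to be widened accordingly (typing ask → ls-Bdet-typer-1, 22:2xZ; theory
to confirm that E-010(i) uniformity is per monomial, hence K-free). Until the widened decl lands: an entangled design
(D2PLUS-SPEC §1) with palette |Π| ≥ 3 is a member of the WIDENED class only; its K = 2 sub-palettes {b_a; b_j, b_l}
(theory's SOS example family, num-1 j260861 F1/F2/SQ cells) are members AS TYPED; det-D2⁺ reports λ_min of every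
3-shift principal sub-block alongside BigF. ConfigPositive (theory (c1)(4)): a member has a VALID POS endgame iff
P₁(ε⊙x) ≥ 0 for every realisable sign vector ε and all x ∈ (0,∞)^K (x_j := Z(t_ρ+αb_j)/(αZ′(t_ρ)) ∈ ℝ, sign
(−1)^{N_j}); validity checklist R-d2p-4: ω ≥ 0; x_j real, x_a > 0 for b_a ∈ {¼,½,¾} (N_a = 0 with the c′α𝓛 tolerance;
b_a = 1 flagged); net operator shape = ONE inverse M′ (printed shape, formula I applies; other M′-powers «unreviewed
(operator shape)»); Ψ₂ discarded as in Prop 7.1.»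

Nothing else changes: the typed class predicates (`KBdet`, `KBdet2`), the verdicts, `bdetWord`/`bdetWord2` and every C2/C4
term are as landed (v1 p476156, Part 5 p477601; REF-E INTAKE-4 INTAKE PASS, verdict 45). Writer of this append:
ls-Bmulti-typer-2 g3 (one pen per append; second reader ls-Bdet-typer-2 g2). «The programme SEARCHES and TYPES; no claim
about Landau–Siegel zeros, Theorems 1–2 of arXiv:2211.02515 or a repaired Margin232 until a kernel theorem says so.» -/

end Repair

end Literature.NumberTheory.LFunctions.Zhang2022
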